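import Summits.CriticalPhenomena.SAWScalingLimit.Theorems.SAWRenewalTightnessTubeLowerBoundBPDOfTailHalvingRenewal

/-!
# Sub-goal `breakPointDensity_of_tailHalving` of the line `profile-potential`
(crux `TubeLowerBound`, stmt-CriticalPhenomena-4730), part II: tail halving ⇒ break-point density

Word model of `SAWWords.lean` / `SAWWordBridges.lean` at the critical fugacity `x_c`
(`criticalFugacity`); the "mass" of a finite family of words is `Σ x_c^{|w|}`; all sums are finite.
HYPOTHESIS (tail halving of Kesten's critical irreducible-bridge span law): for some `δ > 0` and
every `m ≥ 1`, the critical mass of the irreducible bridges of span in `(m, 2m]` is `≥ δ ·` that of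
the irreducible bridges of span `> m`.  CONCLUSION: the break-point-density hypothesis of
`spanRenewalFloor_of_breakPointDensity` (`…SpanFloorOfBPD.lean`), verbatim — so that tail halving
implies Kesten's span-renewal floor.

PROOF.  Part I (`…BPDOfTailHalvingRenewal.lean`, `BPDOfTailHalving.renewalPairs`) gives, at level
`D - 1`, a finite family of pairs `(b, ι)` — `b` a self-avoiding bridge word of span `k ≤ D - 1`,
`ι` an irreducible bridge with `k + span ι ≥ D` — of mass `≥ (1 - 1/(2D))^D ≥ 1/2` (Kesten's
identity `KestenIdentity.exists_partialSum_gt` and Bernoulli, `half_le_pow`).  Group the pairs by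
the prefix `b` (`sum_pairs_eq`); the last factors form a finite family of irreducible bridges of
span `> m = D - 1 - k`, which tail halving (for `m ≥ 1`; the one-step bridge `[+e₀]` for `m = 0`,
using `partialSum_le_one`) replaces by a finite family `G_b` of irreducible bridges of span in
`(m, 2m]` (resp. `= 1`) of mass `≥ min(δ, x_c) ·` the old one (`window`).  The reglued words
`b ++ g`, `g ∈ G_b`, are distinct (unique decoding of the last irreducible factor,
`BPDOfTailHalving.eq_of_append_eq_last`), are self-avoiding bridge words of span
`k + span g ∈ [D, 2D)` all of whose break points lie below `D` (`glued_mem`: up to `|b|` at levels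
`≤ k < D`, none inside the irreducible `g`, `BPD.isBreak_of_append_right`), and have total mass
`≥ min(δ, x_c) / 2 =: c₀`.

References: H. Kesten, *On the number of self-avoiding walks*, J. Math. Phys. 4 (1963), §4
(break points, unique factorisation of bridges, the span renewal); N. Madras, G. Slade,
*The Self-Avoiding Walk* (1993), §4.2, (4.2.1)–(4.2.4).
-/

noncomputable section

namespace Summit.CriticalPhenomena.SAWScalingLimit.Theorems.TubeLowerBound.SubcriticalRenewalFloor

open scoped BigOperators Classical
open Literature.Probability.LatticeModels
open Literature.Probability.RandomPlanarGeometry Literature.Probability.RandomPlanarGeometry.SAW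

namespace BPDOfTailHalving

open Finset

/-! ### Bernoulli -/

/-- `(1 - 1/(2D))^D ≥ 1/2` for `D ≥ 1` (Bernoulli's inequality). [folklore] -/
theorem half_le_pow {D : ℕ} (hD : 1 ≤ D) : (1 : ℝ) / 2 ≤ (1 - 1 / (2 * (D : ℝ))) ^ D := by
  have hD0 : (0 : ℝ) < D := by exact_mod_cast hD
  have hD1 : (1 : ℝ) ≤ D := by exact_mod_cast hD
  have h1 : (1 : ℝ) / (2 * (D : ℝ)) ≤ 1 / 2 :=
    one_div_le_one_div_of_le two_pos (by linarith)
  have h := one_add_mul_le_pow (a := -(1 / (2 * (D : ℝ)))) (by linarith) D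
  have e : 1 + (D : ℝ) * (-(1 / (2 * (D : ℝ)))) = 1 / 2 := by
    field_simp
    ring
  rw [e, ← sub_eq_add_neg] at h
  exact h

/-! ### Grouping a family of pairs by its first component -/

/-- A sum of products over a finite family of pairs, grouped by the first component. [folklore] -/
theorem sum_pairs_eq (P : Finset (List Step × List Step)) (f g : List Step → ℝ) :
    ∑ p ∈ P, f p.1 * g p.2 =
      ∑ b ∈ P.image Prod.fst, f b * ∑ ι ∈ (P.filter (fun p => p.1 = b)).image Prod.snd, g ι := by
  rw [Finset.sum_finset_product P (P.image Prod.fst)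
    (fun b => (P.filter (fun p => p.1 = b)).image Prod.snd) ?_]
  · exact Finset.sum_congr rfl fun b _ => by rw [Finset.mul_sum]
  · rintro ⟨b, ι⟩
    constructor
    · intro h
      exact ⟨Finset.mem_image.2 ⟨(b, ι), h, rfl⟩,
        Finset.mem_image.2 ⟨(b, ι), Finset.mem_filter.2 ⟨h, rfl⟩, rfl⟩⟩
    · rintro ⟨-, h2⟩
      obtain ⟨⟨b', ι'⟩, hq, hι⟩ := Finset.mem_image.1 h2
      obtain ⟨hqP, hb'⟩ := Finset.mem_filter.1 hq
      dsimp only at hb' hι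
      subst hb' hι
      exact hqP

/-! ### The glued words belong to the break-point-density family -/

/-- If `b` is a self-avoiding bridge word of span `< D` and `g` an irreducible bridge with
`D ≤ span b + span g < 2D`, then `b ++ g` is a self-avoiding bridge word of span in `[D, 2D)` all of
whose break points lie below level `D` (those up to `|b|` are at levels `≤ span b`, and there is
none inside the irreducible `g`). [cite: Kesten1963SAW, §4] -/
theorem glued_mem {D : ℕ} {b g : List Step} (hbs : IsSAW b) (hbb : IsBridgeW b)
    (hbD : xEnd b + 1 ≤ (D : ℤ)) (hg : IsIrrBridge g) (hDle : (D : ℤ) ≤ xEnd b + xEnd g)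
    (hlt : xEnd b + xEnd g < 2 * (D : ℤ)) :
    IsSAW (b ++ g) ∧ (IsBridgeW (b ++ g) ∧ (D : ℤ) ≤ xEnd (b ++ g) ∧
      xEnd (b ++ g) < 2 * (D : ℤ) ∧ ∀ j, IsBreak (b ++ g) j → xAt (b ++ g) j < (D : ℤ)) := by
  refine ⟨hbs.append_of_bridge hg.saw hbb hg.bridge, hbb.append hg.bridge,
    by rw [xEnd_append]; exact hDle, by rw [xEnd_append]; exact hlt, fun j hj => ?_⟩
  rcases le_or_gt j b.length with hjb | hjb
  · rw [xAt_append_left b g hjb]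
    have := hbb.xAt_le j
    omega
  · obtain ⟨k, rfl⟩ : ∃ k, j = b.length + k := ⟨j - b.length, by omega⟩
    exact absurd (BPD.isBreak_of_append_right (by omega) hj) (hg.irr k)

/-! ### The windows: truncating the last irreducible factor by tail halving -/

/-- **Window families.** Under the tail-halving hypothesis (constant `δ`): for a prefix span
`0 ≤ k < D` and a finite family `I` of irreducible bridges `ι` with `k + span ι ≥ D`, there is a
finite family `G` of irreducible bridges `g` with `D ≤ k + span g < 2D` and
`mass(G) ≥ min(δ, x_c) · mass(I)`: for `m = D - 1 - k ≥ 1` tail halving at `m` applied to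
`I ⊆ {irreducible, span > m}`; for `m = 0` the one-step bridge `[+e₀]` (`mass(I) ≤ 1`).
[cite: Kesten1963SAW, §4] -/
theorem window {δ : ℝ} (hδ : 0 < δ)
    (hTH : ∀ m : ℕ, 1 ≤ m → ∀ N : ℕ, ∃ N' : ℕ, δ * (∑ n ∈ Finset.range (N + 1), ∑ _w ∈ (sawWords n).filter (fun w => IsIrrBridge w ∧ (m : ℤ) < xEnd w), criticalFugacity ^ n) ≤ ∑ n ∈ Finset.range (N' + 1), ∑ _w ∈ (sawWords n).filter (fun w => IsIrrBridge w ∧ (m : ℤ) < xEnd w ∧ xEnd w ≤ 2 * (m : ℤ)), criticalFugacity ^ n)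
    {k : ℤ} {D : ℕ} (hk0 : 0 ≤ k) (hkD : k + 1 ≤ (D : ℤ)) (I : Finset (List Step))
    (hI : ∀ ι ∈ I, IsIrrBridge ι ∧ (D : ℤ) ≤ k + xEnd ι) :
    ∃ G : Finset (List Step), (∀ g ∈ G, IsIrrBridge g ∧ (D : ℤ) ≤ k + xEnd g ∧
      k + xEnd g < 2 * (D : ℤ)) ∧
      min δ criticalFugacity * ∑ ι ∈ I, criticalFugacity ^ ι.length ≤
        ∑ g ∈ G, criticalFugacity ^ g.length := by
  have hxc : 0 < criticalFugacity := StripMass.criticalFugacity_pos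
  have hInn : 0 ≤ ∑ ι ∈ I, criticalFugacity ^ ι.length :=
    Finset.sum_nonneg fun _ _ => pow_nonneg hxc.le _
  obtain ⟨m, hm⟩ : ∃ m : ℕ, (D : ℤ) - 1 - k = m := Int.eq_ofNat_of_zero_le (by omega)
  rcases Nat.eq_zero_or_pos m with rfl | hm1
  · -- `k = D - 1`: the one-step bridge
    refine ⟨{[(0 : Step)]}, fun g hg => ?_, ?_⟩
    · rw [Finset.mem_singleton] at hg
      subst hg
      have hx1 : xEnd [(0 : Step)] = 1 := by decide
      refine ⟨Renewal.isIrrBridge_single, ?_, ?_⟩ <;> rw [hx1] <;> push_cast at hm ⊢ <;> omega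
    · rw [Finset.sum_singleton, List.length_singleton, pow_one]
      calc min δ criticalFugacity * ∑ ι ∈ I, criticalFugacity ^ ι.length
          ≤ criticalFugacity * 1 :=
            mul_le_mul (min_le_right _ _) (KestenIdentity.partialSum_le_one I fun ι hι => (hI ι hι).1)
              hInn hxc.le
        _ = criticalFugacity := mul_one _
  · -- `m ≥ 1`: tail halving at `m`
    set N := I.sup List.length with hN
    obtain ⟨N', hN'⟩ := hTH m hm1 N
    rw [SpanFloor.sum_range_filter_eq, SpanFloor.sum_range_filter_eq] at hN'
    refine ⟨(Finset.range (N' + 1)).biUnion (fun n => (sawWords n).filter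
      (fun w => IsIrrBridge w ∧ (m : ℤ) < xEnd w ∧ xEnd w ≤ 2 * (m : ℤ))), fun g hg => ?_, ?_⟩
    · obtain ⟨-, -, hirr, h1, h2⟩ := SpanFloor.mem_biUnion_filter.1 hg
      exact ⟨hirr, by omega, by omega⟩
    · have hsub : I ⊆ (Finset.range (N + 1)).biUnion (fun n => (sawWords n).filter
          (fun w => IsIrrBridge w ∧ (m : ℤ) < xEnd w)) := by
        intro ι hι
        obtain ⟨hirr, hD⟩ := hI ι hι
        exact SpanFloor.mem_biUnion_filter.2 ⟨Finset.le_sup (f := List.length) hι, hirr.saw, hirr,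
          by omega⟩
      calc min δ criticalFugacity * ∑ ι ∈ I, criticalFugacity ^ ι.length
          ≤ δ * ∑ ι ∈ I, criticalFugacity ^ ι.length :=
            mul_le_mul_of_nonneg_right (min_le_left _ _) hInn
        _ ≤ δ * ∑ w ∈ (Finset.range (N + 1)).biUnion (fun n => (sawWords n).filter
              (fun w => IsIrrBridge w ∧ (m : ℤ) < xEnd w)), criticalFugacity ^ w.length :=
            mul_le_mul_of_nonneg_left (Finset.sum_le_sum_of_subset_of_nonneg hsub
              fun _ _ _ => pow_nonneg hxc.le _) hδ.le
        _ ≤ _ := hN'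

end BPDOfTailHalving

/-- **Tail halving ⇒ break-point density** (registered sub-goal `breakPointDensity_of_tailHalving`
of the crux item, census link: tail halving of Kesten's critical irreducible-bridge span law ⇒ the
hypothesis of `spanRenewalFloor_of_breakPointDensity`, hence ⇒ Kesten's span-renewal floor).
HYPOTHESIS: for some `δ > 0` and every `m ≥ 1`, the critical mass of the irreducible bridges of
span in `(m, 2m]` is at least `δ` times that of the irreducible bridges of span `> m` (finite
truncations).  CONCLUSION: for some `c₀ > 0` and every `D ≥ 1`, the critical mass of the bridge
words of span in `[D, 2D)` all of whose break points lie below level `D` is `≥ c₀`.  PROOF: the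
renewal families of pairs `(b, ι)` at level `D - 1` (`BPDOfTailHalving.renewalPairs`, mass `≥ 1/2`
by Kesten's identity and Bernoulli) are grouped by the prefix `b` (span `k < D`); the family of last
factors `ι` (irreducible, span `> D - 1 - k`) is replaced by a window family `G_b` of irreducible
bridges of span in `[D - k, 2D - 1 - k)` of mass `≥ min(δ, x_c) ·` (tail halving,
`BPDOfTailHalving.window`); the reglued words `b ++ g` are distinct
(`BPDOfTailHalving.eq_of_append_eq_last`), belong to the family (`BPDOfTailHalving.glued_mem`),
and have total mass `≥ min(δ, x_c) / 2 = c₀`. [cite: Kesten1963SAW, §4] -/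
theorem breakPointDensity_of_tailHalving :
    (∃ δ : ℝ, 0 < δ ∧ ∀ m : ℕ, 1 ≤ m → ∀ N : ℕ, ∃ N' : ℕ, δ * (∑ n ∈ Finset.range (N + 1), ∑ _w ∈ (sawWords n).filter (fun w => IsIrrBridge w ∧ (m : ℤ) < xEnd w), criticalFugacity ^ n) ≤ ∑ n ∈ Finset.range (N' + 1), ∑ _w ∈ (sawWords n).filter (fun w => IsIrrBridge w ∧ (m : ℤ) < xEnd w ∧ xEnd w ≤ 2 * (m : ℤ)), criticalFugacity ^ n) → ∃ c₀ : ℝ, 0 < c₀ ∧ ∀ D : ℕ, 1 ≤ D → ∃ N : ℕ, c₀ ≤ ∑ n ∈ Finset.range (N + 1), ∑ _w ∈ (sawWords n).filter (fun w => IsBridgeW w ∧ (D : ℤ) ≤ xEnd w ∧ xEnd w < 2 * (D : ℤ) ∧ ∀ j, IsBreak w j → xAt w j < (D : ℤ)), criticalFugacity ^ n := by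
  rintro ⟨δ, hδ, hTH⟩
  have hxc : 0 < criticalFugacity := StripMass.criticalFugacity_pos
  set δ' : ℝ := min δ criticalFugacity with hδ'
  have hδ'0 : 0 < δ' := lt_min hδ hxc
  refine ⟨δ' / 2, by positivity, fun D hD => ?_⟩
  -- a family `S₀` of irreducible bridges of mass `> A = 1 - 1/(2D)` (Kesten's identity)
  set A : ℝ := 1 - 1 / (2 * (D : ℝ)) with hA
  have hD0 : (0 : ℝ) < D := by exact_mod_cast hD
  have hA0 : 0 ≤ A := by
    have hD1 : (1 : ℝ) ≤ D := by exact_mod_cast hD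
    have h1 : (1 : ℝ) / (2 * (D : ℝ)) ≤ 1 / 2 :=
      one_div_le_one_div_of_le two_pos (by linarith)
    rw [hA]; linarith
  have hA1 : A < 1 := by
    have : (0 : ℝ) < 1 / (2 * (D : ℝ)) := by positivity
    rw [hA]; linarith
  have hAD : (1 : ℝ) / 2 ≤ A ^ D := BPDOfTailHalving.half_le_pow hD
  obtain ⟨S₀, hS₀, hAS⟩ := KestenIdentity.exists_partialSum_gt hA1
  -- the renewal family of pairs at level `D - 1`
  obtain ⟨P, hP, hmass⟩ := BPDOfTailHalving.renewalPairs hA0 hS₀ hAS.le (D - 1)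
  rw [Nat.sub_add_cancel hD] at hmass
  have hcast : ((D - 1 : ℕ) : ℤ) = (D : ℤ) - 1 := by
    rw [Nat.cast_sub hD, Nat.cast_one]
  -- grouping by the prefix
  set B : Finset (List Step) := P.image Prod.fst with hB
  set I : List Step → Finset (List Step) :=
    fun b => (P.filter (fun p => p.1 = b)).image Prod.snd with hI
  have hBspec : ∀ b ∈ B, IsSAW b ∧ IsBridgeW b ∧ 0 ≤ xEnd b ∧ xEnd b + 1 ≤ (D : ℤ) := by
    intro b hb
    obtain ⟨p, hp, rfl⟩ := Finset.mem_image.1 hb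
    obtain ⟨hs, hbr, hx, -, -⟩ := hP p hp
    rw [hcast] at hx
    exact ⟨hs, hbr, hbr.xEnd_nonneg, by omega⟩
  have hIspec : ∀ b ∈ B, ∀ ι ∈ I b, IsIrrBridge ι ∧ (D : ℤ) ≤ xEnd b + xEnd ι := by
    intro b _ ι hι
    obtain ⟨p, hp, rfl⟩ := Finset.mem_image.1 hι
    obtain ⟨hpP, hpb⟩ := Finset.mem_filter.1 hp
    obtain ⟨-, -, -, hirr, hsp⟩ := hP p hpP
    rw [hcast] at hsp
    rw [← hpb]
    exact ⟨hirr, by omega⟩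
  have hgroup : ∑ p ∈ P, criticalFugacity ^ (p.1.length + p.2.length) =
      ∑ b ∈ B, criticalFugacity ^ b.length * ∑ ι ∈ I b, criticalFugacity ^ ι.length := by
    rw [← BPDOfTailHalving.sum_pairs_eq]
    exact Finset.sum_congr rfl fun p _ => pow_add _ _ _
  -- the windows
  have hwin : ∀ b, ∃ G : Finset (List Step), b ∈ B →
      (∀ g ∈ G, IsIrrBridge g ∧ (D : ℤ) ≤ xEnd b + xEnd g ∧ xEnd b + xEnd g < 2 * (D : ℤ)) ∧
        δ' * ∑ ι ∈ I b, criticalFugacity ^ ι.length ≤ ∑ g ∈ G, criticalFugacity ^ g.length := by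
    intro b
    by_cases hb : b ∈ B
    · obtain ⟨G, hG⟩ := BPDOfTailHalving.window hδ hTH (hBspec b hb).2.2.1 (hBspec b hb).2.2.2
        (I b) (hIspec b hb)
      exact ⟨G, fun _ => hG⟩
    · exact ⟨∅, fun h => absurd h hb⟩
  choose G hG using hwin
  -- the reglued family
  set F : Finset (List Step) := (B.sigma fun b => G b).image (fun q => q.1 ++ q.2) with hF
  refine ⟨F.sup List.length, ?_⟩
  rw [SpanFloor.sum_range_filter_eq]
  have hsub : F ⊆ (Finset.range (F.sup List.length + 1)).biUnion (fun n => (sawWords n).filter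
      (fun w => IsBridgeW w ∧ (D : ℤ) ≤ xEnd w ∧ xEnd w < 2 * (D : ℤ) ∧
        ∀ j, IsBreak w j → xAt w j < (D : ℤ))) := by
    intro u hu
    rw [SpanFloor.mem_biUnion_filter]
    refine ⟨Finset.le_sup (f := List.length) hu, ?_⟩
    obtain ⟨⟨b, g⟩, hq, rfl⟩ := Finset.mem_image.1 hu
    obtain ⟨hb, hg⟩ := Finset.mem_sigma.1 hq
    obtain ⟨hbs, hbb, -, hbD⟩ := hBspec b hb
    obtain ⟨hgirr, hDle, hlt⟩ := (hG b hb).1 g hg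
    exact BPDOfTailHalving.glued_mem hbs hbb hbD hgirr hDle hlt
  have hFsum : ∑ u ∈ F, criticalFugacity ^ u.length =
      ∑ b ∈ B, criticalFugacity ^ b.length * ∑ g ∈ G b, criticalFugacity ^ g.length := by
    rw [hF, Finset.sum_image, Finset.sum_sigma]
    · refine Finset.sum_congr rfl fun b _ => ?_
      rw [Finset.mul_sum]
      refine Finset.sum_congr rfl fun g _ => ?_
      rw [List.length_append, pow_add]
    · rintro ⟨b, g⟩ hq ⟨b', g'⟩ hq' heq
      rw [Finset.mem_coe, Finset.mem_sigma] at hq hq'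
      change b ++ g = b' ++ g' at heq
      obtain ⟨rfl, rfl⟩ := BPDOfTailHalving.eq_of_append_eq_last (hBspec b hq.1).2.1
        (hBspec b' hq'.1).2.1 ((hG b hq.1).1 g hq.2).1 ((hG b' hq'.1).1 g' hq'.2).1 heq
      rfl
  calc δ' / 2 = δ' * (1 / 2) := by ring
    _ ≤ δ' * A ^ D := mul_le_mul_of_nonneg_left hAD hδ'0.le
    _ ≤ δ' * ∑ p ∈ P, criticalFugacity ^ (p.1.length + p.2.length) :=
        mul_le_mul_of_nonneg_left hmass hδ'0.le
    _ = ∑ b ∈ B, criticalFugacity ^ b.length * (δ' * ∑ ι ∈ I b, criticalFugacity ^ ι.length) := by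
        rw [hgroup, Finset.mul_sum]
        exact Finset.sum_congr rfl fun b _ => by ring
    _ ≤ ∑ b ∈ B, criticalFugacity ^ b.length * ∑ g ∈ G b, criticalFugacity ^ g.length :=
        Finset.sum_le_sum fun b hb => mul_le_mul_of_nonneg_left (hG b hb).2 (pow_nonneg hxc.le _)
    _ = ∑ u ∈ F, criticalFugacity ^ u.length := hFsum.symm
    _ ≤ _ := Finset.sum_le_sum_of_subset_of_nonneg hsub fun _ _ _ => pow_nonneg hxc.le _

end Summit.CriticalPhenomena.SAWScalingLimit.Theorems.TubeLowerBound.SubcriticalRenewalFloor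

end
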